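import Literature.IUT.LogThetaLattice.HolomorphicLogShells
import Literature.IUT.LogThetaLattice.LocalLogShellsProofs
import Literature.IUT.LogThetaLattice.LogLinkIterates
import Literature.AnabelianGeometry.AbsoluteAnabelian.LogShellsOfUnitLog
import Literature.AnabelianGeometry.AbsoluteAnabelian.LogIsometricUnitLog
import Literature.AnabelianGeometry.AbsoluteAnabelian.LocalVolumesNonarchimedeanProofs
import Literature.IUT.LogVolume.LogShellTopology
import Literature.IUT.LogVolume.RamificationInvariants
import Literature.IUT.LogVolume.LocalFieldVolume
import HarnessLib

/-!
# [IUTchIII] Proposition 1.2 (iii), (v), (vi) at the GENUINE `p`-adic logarithm — proof-only companion of `HolomorphicLogShells.lean`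

Mochizuki, *Inter-universal Teichmüller Theory III*, kurims manuscript (May 2020), §1, Prop 1.2 (iii), (v),
(vi), pp. 31–32 (claim key `Mochizuki2012`, D-0012, status disputed). PROOF-ONLY companion (no new
definitions) of abc-iut-L6-t3's `Literature.IUT.LogThetaLattice.HolomorphicLogShells` (p404642): that file
typed the one-place content of Prop 1.2 over abc-iut-L4-t3's HYPOTHESIS STRUCTURE `PadicLogOnUnits K`
([AbsTopIII] Def 5.4 (iii)) and left the analytic inputs as explicit hypotheses / predicates
(`hcont`, `hpow`, `LogLinkVolumeCompatible`, `HolMonoVolumeCompatible`). Here every one of them is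
DISCHARGED at the standard model `PadicLogOnUnits.ofUnitLog p K` (abc-iut-L3-t11, `LogShellsOfUnitLog`),
i.e. at abc-iut-S1's real `p`-adic logarithm `unitLog = log_p : 𝒪_K^× → K` of a mixed-characteristic
local field `K` in the cell's norm-side setting
`[NormedAlgebra ℚ_[p] K] [IsUltrametricDist K] [ProperSpace K]`:

* Prop 1.2 (v) (a^{non}) "`I_{†F_v}` is compact, hence of finite log-volume": `isCompact_logShell_ofUnitLog`,
  `isOpen_logShell_ofUnitLog`, `logShell_ofUnitLog_mem_compactOpens` (the log-shell
  `ℐ_K = (p*)⁻¹·log_p(𝒪_K^×)` is a nonempty compact open subset, so `μ_K^log(ℐ_K)` is defined), from S1's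
  `continuousOn_unitLog` / `isOpen_logUnits`; (c^{non}) "`I_{†F_v}` contains the image of … `Ψ^×_{†F_v}`":
  `logUnits_subset_logShell_ofUnitLog` (`log_p(𝒪_K^×) ⊆ ℐ_K`), the `hpow` hypothesis of t3's
  `preLogShell_subset_logShell` being S1's `unitLog_pow`.
* Prop 1.2 (iii) "compatible with the natural `p_v`-adic log-volumes [[AbsTopIII] Prop 5.7 (i)(c)]":
  `logLinkVolumeCompatible_ofUnitLog` — t3's predicate `LogLinkVolumeCompatible (ofUnitLog p K) e` for every
  ISOMETRIC field isomorphism `e : K ≃+* K'` (the identification `log(†F_v) ⥲ Ψ^{gp}_{‡F_v}` with the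
  codomain), from abc-iut-L3-t11's `logVolumeCompatible_unitLog_of` + abc-iut-L4-t8's
  `LogVolumeCompatibleOfIsometric_holds` / `localLogVolume_image_of_isometry`.
* Prop 1.2 (vi) "compatible with … the respective log-volumes", numerically
  `μ^log(ℐ_K) = [AbsTopIII] Prop 5.8 (iii)`: the SCALING IDENTITY
  `μ_K(ℐ_K) = p^{f·e·c} · μ_K(log_p(𝒪_K^×))` (`localVolume_logShell_ofUnitLog`; `c = 2` if `p = 2`, else `1`;
  `‖p*‖ = ‖ϖ‖^{e·c}`, `μ_K(𝔪^n) = p^{-f n}`), hence t3's `HolMonoVolumeCompatible (ofUnitLog p K) t` for every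
  numerical type `t = (p, f, e, m)` of `K` GIVEN the value `μ_K^log(log_p(𝒪_K^×)) = -(f + m)·log p`
  (`holMonoVolumeCompatible_ofUnitLog_of_logUnits`). That value is [IUTchIV] Prop 1.4 (ii)
  (`μ_K(log_p(R^×))·#R^μ = μ_K(R^×)`, abc-iut-S8 `UnitLogCount`, p405657, with `#R^μ = p^m(p^f − 1)`,
  abc-iut-S1 `TorsionUnits`, p405169); the unconditional form is assembled in the sequel companion once
  those two files are built (one writer per fact: the count is S8's, not re-proved here).

Dictionary of the two volume vocabularies in the tree (ONE measure, two names — abc-iut-L4-t8's bridge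
`localVolume_eq_haar_toReal_of_coe_eq`): `Literature.AnabelianGeometry.AbsoluteAnabelian.localVolume K A : ℝ`
(abc-iut-L4-t3, used by t3's predicates) `= (Literature.IUT.LogVolume.localVolume K A).toReal` (abc-iut-S2's
measure), `localVolume_eq_toReal`. Dictionary of the two concrete log-shells of L6 at the real logarithm:
abc-iut-L6-t3's `nonarchLogShell O logk p` (`LocalLogShells.lean`, the D4-canonical L6 shell) `=`
`logShell (ofUnitLog p K)` (`nonarchLogShell_eq_logShell_ofUnitLog`, over abc-iut-L3-t11's
`LocalLogShellsProofs`), and the `hc` hypothesis of t3's `LogLinkIterates.iterate_image_subset_logShell`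
([IUTchIII] Rmk 1.2.2 (iii), upper semi-commutativity) discharged (`iterate_image_subset_logShell_ofUnitLog`).
Head-start drafts for this companion by abc-iut-L6-t5 and abc-iut-L3-t11 (both yielded it, INBOX
2026-08-25T19:47Z/19:49Z) are gratefully acknowledged; the dictionary lemma follows abc-iut-L3-t11's draft.

All statements here are classical local-field facts (Neukirch ANT II §5; Weil BNT I §4); the [IUTchIII]
locators record which printed clauses they kernel-check. Nothing in this file bears on the disputed
[IUTchIII] Cor 3.12 or takes a side; typed ≠ discharged elsewhere.
-/

noncomputable section

namespace Literature.IUT.LogThetaLattice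

open Set Metric MeasureTheory
open scoped Pointwise NNReal ENNReal
open Literature.AnabelianGeometry.AbsoluteAnabelian
open Literature.IUT.LogVolume (unitLog unitLog_pow continuousOn_unitLog isCompact_logUnits
  isOpen_logUnits zero_mem_logUnits absRamificationIdx residueDegree norm_prime_eq_norm_pow
  card_residueField)
open Literature.NumberTheory.GaloisRepresentations.Ultrametric

variable (p : ℕ) [Fact p.Prime]
variable (K : Type*) [NontriviallyNormedField K] [instK : NormedAlgebra ℚ_[p] K] [IsUltrametricDist K]
  [ProperSpace K]

/-! ### Prop 1.2 (v): the log-shell of the real logarithm is a nonempty compact open set -/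

/-- **IUTchIII:Prop1.2(v)** (kurims p.31) the `hcont` hypothesis of t3's `isCompact_logShell`, DISCHARGED:
the real `p`-adic logarithm is continuous on the unit sphere `𝒪_K^× = {‖x‖ = 1}` (abc-iut-S1
`continuousOn_unitLog`). [claim: Mochizuki2012, status: disputed] -/
theorem continuousOn_log_ofUnitLog :
    ContinuousOn (PadicLogOnUnits.ofUnitLog p K).log (sphere (0 : K) 1) := by
  have h := continuousOn_unitLog p K
  have hs : sphere (0 : K) 1 = {u : K | ‖u‖ = 1} := by
    ext u
    simp
  rw [PadicLogOnUnits.ofUnitLog_log, hs]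
  exact h

/-- **IUTchIII:Prop1.2(v)** (kurims p.31) (a^{non}) "`I_{†F_v}` is compact" — UNCONDITIONALLY for the log-shell
`ℐ_K = (p*)⁻¹ · log_p(𝒪_K^×)` of the real logarithm. [claim: Mochizuki2012, status: disputed] -/
theorem isCompact_logShell_ofUnitLog : IsCompact (logShell (PadicLogOnUnits.ofUnitLog p K)) :=
  isCompact_logShell _ (continuousOn_log_ofUnitLog p K)

/-- **IUTchIII:Prop1.2(v)** (kurims p.31) the log-shell `ℐ_K` of the real logarithm is OPEN (it is
`(p*)⁻¹ · log_p(𝒪_K^×)` and `log_p(𝒪_K^×)` is an open subgroup, abc-iut-S1 `isOpen_logUnits`).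
[claim: Mochizuki2012, status: disputed] -/
theorem isOpen_logShell_ofUnitLog : IsOpen (logShell (PadicLogOnUnits.ofUnitLog p K)) := by
  rw [logShell_ofUnitLog]
  exact (isOpen_logUnits p K).smul₀ (inv_ne_zero (pstarNat_cast_ne_zero p K))

/-- **IUTchIII:Prop1.2(v)** (kurims pp.31–32) `0 ∈ ℐ_K` (indeed `𝒪_K ⊆ ℐ_K`, [AbsTopIII] Def 5.4 (iii);
abc-iut-L3-t11 `closedBall_subset_logShell_ofUnitLog`). [claim: Mochizuki2012, status: disputed] -/
theorem zero_mem_logShell_ofUnitLog : (0 : K) ∈ logShell (PadicLogOnUnits.ofUnitLog p K) :=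
  closedBall_subset_logShell_ofUnitLog p K (mem_closedBall_self zero_le_one)

/-- **IUTchIII:Prop1.2(v)** (kurims p.31) (a^{non}) "`I_{†F_v}` is compact, hence of finite log-volume":
`ℐ_K ∈ M(K)` — a nonempty compact open subset of `K`, i.e. an admissible argument of the log-volume
`μ_K^log` of [AbsTopIII] Prop 5.7 (i) (this is also the content of abc-iut-L4-t3's [AbsTopIII] Cor 5.10 (i)
predicate `LogShellFiniteVolume` at the standard model). [claim: Mochizuki2012, status: disputed] -/
theorem logShell_ofUnitLog_mem_compactOpens :
    logShell (PadicLogOnUnits.ofUnitLog p K) ∈ compactOpens K :=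
  ⟨⟨0, zero_mem_logShell_ofUnitLog p K⟩, isCompact_logShell_ofUnitLog p K, isOpen_logShell_ofUnitLog p K⟩

/-- **IUTchIII:Prop1.2(v)** (kurims p.31) (a^{non}) "… hence of finite log-volume": the normalised Haar
measure of `ℐ_K` is finite, UNCONDITIONALLY (t3's `localHaar_logShell_lt_top` with its `hcont` discharged).
[claim: Mochizuki2012, status: disputed] -/
theorem localHaar_logShell_ofUnitLog_lt_top [MeasurableSpace K] [BorelSpace K] :
    localHaar K (logShell (PadicLogOnUnits.ofUnitLog p K)) < ⊤ :=
  (isCompact_logShell_ofUnitLog p K).measure_lt_top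

/-- **IUTchIII:Prop1.2(v)** (kurims p.32) the `hpow` hypothesis of t3's `preLogShell_subset_logShell`,
DISCHARGED: the power rule `log_p(x^{p*}) = p*·log_p(x)` on units (abc-iut-S1 `unitLog_pow`).
[claim: Mochizuki2012, status: disputed] -/
theorem log_pow_pstar_ofUnitLog (x : K) (hx : x ∈ sphere (0 : K) 1) :
    (PadicLogOnUnits.ofUnitLog p K).log (x ^ (p ^ (if p = 2 then 2 else 1))) =
      ((p ^ (if p = 2 then 2 else 1) : ℕ) : K) * (PadicLogOnUnits.ofUnitLog p K).log x := by
  rw [PadicLogOnUnits.ofUnitLog_log]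
  exact unitLog_pow p (mem_sphere_zero_iff_norm.mp hx) _

/-- **IUTchIII:Prop1.2(v)** (kurims p.32) (c^{non}) "`I_{†F_v}` contains the image of the submonoid of
`†Π_v`-invariants of `Ψ^×_{†F_v}`", i.e. `log_p(𝒪_K^×) ⊆ ℐ_K` [Rmk 1.2.2 (i)], UNCONDITIONALLY for the real
logarithm (t3's `preLogShell_subset_logShell` at the standard model). [claim: Mochizuki2012, status: disputed] -/
theorem preLogShell_subset_logShell_ofUnitLog :
    preLogShell (PadicLogOnUnits.ofUnitLog p K) ⊆ logShell (PadicLogOnUnits.ofUnitLog p K) :=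
  preLogShell_subset_logShell _ (p ^ (if p = 2 then 2 else 1)) rfl (log_pow_pstar_ofUnitLog p K)

/-- **IUTchIII:Prop1.2(v)** (kurims p.32) (c^{non}) in abc-iut-S1's vocabulary: `log_p(R^×) ⊆ ℐ_K`.
[claim: Mochizuki2012, status: disputed] -/
theorem logUnits_subset_logShell_ofUnitLog :
    LogVolume.logUnits K ⊆ logShell (PadicLogOnUnits.ofUnitLog p K) := by
  rw [← preLogShell_ofUnitLog p K]
  exact preLogShell_subset_logShell_ofUnitLog p K

include instK in
/-- `log_p(R^×) ∈ M(K)`: nonempty (`0 = log_p 1`), compact and open (abc-iut-S1 `logUnits_compact_open`).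
[claim: Mochizuki2012, status: disputed] -/
theorem logUnits_mem_compactOpens : LogVolume.logUnits K ∈ compactOpens K :=
  ⟨⟨0, zero_mem_logUnits (p := p)⟩, isCompact_logUnits p K, isOpen_logUnits p K⟩

/-! ### Prop 1.2 (iii): log-volume compatibility of the log-link at the real logarithm -/

/-- **IUTchIII:Prop1.2(iii)** (kurims p.31) first conjunct of t3's `LogLinkVolumeCompatible`: the real
logarithm is log-volume compatible in the sense of [AbsTopIII] Prop 5.7 (i)(c)
(`μ_K^log(A) = μ_K^log(log_p(A))` for compact open `A ⊆ 𝒪_K^×` on which `log_p` is injective) —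
abc-iut-L3-t11's `logVolumeCompatible_unitLog_of` fed with abc-iut-L4-t8's discharge
`LogVolumeCompatibleOfIsometric_holds`. [claim: Mochizuki2012, status: disputed] -/
theorem logVolumeCompatible_ofUnitLog [MeasurableSpace K] [BorelSpace K] :
    LogVolumeCompatible (PadicLogOnUnits.ofUnitLog p K).log :=
  logVolumeCompatible_unitLog_of p LogVolumeCompatibleOfIsometric_holds

/-- **IUTchIII:Prop1.2(iii)** (kurims p.31) "At `v ∈ V̲^{non}`, the diagram (∗non) is compatible with the
natural `p_v`-adic log-volumes [cf. [AbsTopIII], Proposition 5.7, (i), (c); Corollary 5.10, (ii)]":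
t3's predicate `LogLinkVolumeCompatible` HOLDS at the standard model for every ISOMETRIC identification
`e : K ≃+* K'` of `log(†F_v)` with the codomain `Ψ^{gp}_{‡F_v}` (log-volumes are intrinsic: abc-iut-L4-t8
`localLogVolume_image_of_isometry`). [claim: Mochizuki2012, status: disputed] -/
theorem logLinkVolumeCompatible_ofUnitLog [MeasurableSpace K] [BorelSpace K]
    {K' : Type*} [NontriviallyNormedField K'] [IsUltrametricDist K'] [ProperSpace K'] [MeasurableSpace K']
    [BorelSpace K'] (e : K ≃+* K') (he : Isometry e) :
    LogLinkVolumeCompatible (PadicLogOnUnits.ofUnitLog p K) e :=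
  ⟨logVolumeCompatible_ofUnitLog p K, fun _ hA => localLogVolume_image_of_isometry e.toAddEquiv he hA⟩

/-! ### Prop 1.2 (vi): the log-volume of the holomorphic log-shell — the scaling identity -/

omit instK in
/-- Dictionary (one volume, two names): abc-iut-L4-t3's real-valued `μ_K(A) = localVolume K A` is the real
part of abc-iut-S2's measure `Literature.IUT.LogVolume.localVolume K` (abc-iut-L4-t8's bridge
`localVolume_eq_haar_toReal_of_coe_eq` at S2's `unitBallStructure`).
[cite: MochizukiAbsTopIII2015, Prop 5.7 (i)(a) p. 137] -/
theorem localVolume_eq_toReal [MeasurableSpace K] [BorelSpace K] (A : Set K) :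
    localVolume K A = (LogVolume.localVolume K A).toReal :=
  localVolume_eq_haar_toReal_of_coe_eq (LogVolume.unitBallStructure K) (LogVolume.coe_unitBallStructure K) A

/-- `#(𝒪_K/𝔪_K) = p^f`: abc-iut-S2's `residueCard K` is `p ^ residueDegree p K` (abc-iut-S1
`card_residueField`). [cite: MochizukiAbsTopIII2015, Prop 5.8 (i) p. 139] -/
theorem residueCard_eq_pow : LogVolume.residueCard K = p ^ residueDegree p K :=
  card_residueField p K

/-- `‖p*‖ = ‖ϖ‖^{e·c}` for every norm uniformizer `ϖ` (`c = 2` if `p = 2`, else `1`; `‖p‖ = ‖ϖ‖^e`,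
abc-iut-S1 `norm_prime_eq_norm_pow`). [cite: MochizukiAbsTopIII2015, Prop 5.8 (i) p. 139] -/
theorem norm_pstar_ofUnitLog {ϖ : Kˣ} (hϖ : IsUniformizer ϖ) :
    ‖(PadicLogOnUnits.ofUnitLog p K).pstar‖ =
      ‖(ϖ : K)‖ ^ (absRamificationIdx p K * (if p = 2 then 2 else 1)) := by
  rw [PadicLogOnUnits.ofUnitLog_pstar, Nat.cast_pow, norm_pow, norm_prime_eq_norm_pow p K hϖ, ← pow_mul]

/-- The module of `p* ∈ K^×`: `μ̇_K(p*) = |p*|_K = p^{-f·e·c}` (`μ_K(𝔪_K^n) = q^{-n}`, abc-iut-S2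
`localVolume_real_closedBall_zpow`; `q = p^f`). [cite: MochizukiAbsTopIII2015, Prop 5.7 (i)(b) p. 138] -/
theorem distribHaarChar_pstar [MeasurableSpace K] [BorelSpace K] :
    ((distribHaarChar K (Units.mk0 _ (PadicLogOnUnits.ofUnitLog p K).pstar_ne_zero) : ℝ≥0) : ℝ) =
      ((p : ℝ) ^ (residueDegree p K * (absRamificationIdx p K * (if p = 2 then 2 else 1))))⁻¹ := by
  obtain ⟨ϖ, hϖ⟩ := exists_isUniformizer (F := K)
  have hq : (LogVolume.residueCard K : ℝ) = (p : ℝ) ^ residueDegree p K := by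
    rw [residueCard_eq_pow p K, Nat.cast_pow]
  rw [← unitVolume_eq_distribHaarChar, unitVolume, units_smul_unitBall, Units.val_mk0,
    norm_pstar_ofUnitLog p K hϖ, localVolume_eq_toReal, ← zpow_natCast,
    LogVolume.localVolume_real_closedBall_zpow K hϖ, hq, zpow_neg, zpow_natCast, ← pow_mul]

/-- **IUTchIII:Prop1.2(vi)** (kurims p.32) THE SCALING IDENTITY behind "compatible with … the respective
log-volumes": `μ_K(ℐ_K) = p^{f·e·c} · μ_K(log_p(𝒪_K^×))` for the log-shell `ℐ_K = (p*)⁻¹·log_p(𝒪_K^×)` of the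
real logarithm ([AbsTopIII] Prop 5.7 (i)(b): `μ_K(x·A) = |x|_K·μ_K(A)` with `|p*|_K = p^{-f e c}`).
[claim: Mochizuki2012, status: disputed] -/
theorem localVolume_logShell_ofUnitLog [MeasurableSpace K] [BorelSpace K] :
    localVolume K (logShell (PadicLogOnUnits.ofUnitLog p K)) =
      (p : ℝ) ^ (residueDegree p K * (absRamificationIdx p K * (if p = 2 then 2 else 1))) *
        localVolume K (LogVolume.logUnits K) := by
  have hshell : logShell (PadicLogOnUnits.ofUnitLog p K) =
      (Units.mk0 _ (PadicLogOnUnits.ofUnitLog p K).pstar_ne_zero)⁻¹ • LogVolume.logUnits K := by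
    rw [Units.smul_def, Units.val_inv_eq_inv_val, Units.val_mk0, ← preLogShell_ofUnitLog p K]
    rfl
  rw [hshell, localVolume_units_smul, map_inv, NNReal.coe_inv, distribHaarChar_pstar p K, inv_inv]

/-- **IUTchIII:Prop1.2(vi)** (kurims p.32) log form: `μ_K^log(ℐ_K) = f·e·c·log p + μ_K^log(log_p(𝒪_K^×))`.
[claim: Mochizuki2012, status: disputed] -/
theorem localLogVolume_logShell_ofUnitLog [MeasurableSpace K] [BorelSpace K] :
    localLogVolume K (logShell (PadicLogOnUnits.ofUnitLog p K)) =
      (residueDegree p K * (absRamificationIdx p K * (if p = 2 then 2 else 1)) : ℕ) * Real.log p +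
        localLogVolume K (LogVolume.logUnits K) := by
  have hpos : 0 < localVolume K (LogVolume.logUnits K) := localVolume_pos (logUnits_mem_compactOpens p K)
  have hp0 : (0 : ℝ) < p := by exact_mod_cast (Fact.out : p.Prime).pos
  rw [localLogVolume, localVolume_logShell_ofUnitLog p K, Real.log_mul (pow_pos hp0 _).ne' hpos.ne',
    Real.log_pow, localLogVolume]

/-- **IUTchIII:Prop1.2(vi)** (kurims p.32) "the various isomorphisms `log(†D^⊢_v) ⥲ log(†F^{⊢×μ}_v) ⥲ log(†F_v)`
… are compatible with … the respective log-shells, and the respective log-volumes": t3's predicate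
`HolMonoVolumeCompatible (ofUnitLog p K) t` — `μ_K^log(ℐ_K) =` abc-iut-L4-t3's mono-analytic value
`t.logShellLogVolume = (-1 - m/f + e·log(p*)/log p)·f·log p` of [AbsTopIII] Prop 5.8 (iii) — HOLDS for every
numerical type `t = (p, f, e, m)` of `K`, GIVEN the value `μ_K^log(log_p(𝒪_K^×)) = -(f + m)·log p` of
[IUTchIV] Prop 1.4 (ii) (`μ_K(log_p(R^×))·#R^μ = μ_K(R^×) = 1 - p^{-f}`, `#R^μ = p^m(p^f − 1)`; abc-iut-S8
`UnitLogCount`, abc-iut-S1 `TorsionUnits` — consumed by name in the sequel companion, not re-proved).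
[claim: Mochizuki2012, status: disputed] -/
theorem holMonoVolumeCompatible_ofUnitLog_of_logUnits [MeasurableSpace K] [BorelSpace K] (t : MLFType)
    (hp : t.p = p) (hf : t.f = residueDegree p K) (he : t.e = absRamificationIdx p K)
    (hvol : localLogVolume K (LogVolume.logUnits K) = -((t.f + t.m : ℕ) * Real.log p)) :
    HolMonoVolumeCompatible (PadicLogOnUnits.ofUnitLog p K) t := by
  unfold HolMonoVolumeCompatible
  rw [localLogVolume_logShell_ofUnitLog p K, hvol, MLFType.logShellLogVolume_eq', hp, ← hf, ← he]
  push_cast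
  split_ifs <;> ring

/-! ### Dictionary with `LocalLogShells.lean` and `LogLinkIterates.lean` at the real logarithm -/

/-- `p* = p` (odd `p`), `p² = 4` (`p = 2`): abc-iut-L6-t3's `pStar p` ([IUTchIII] Def 1.1 (i) p.24) is the
exponent form `p^{1 or 2}` of the standard model `ofUnitLog`, for `p` prime (after abc-iut-L3-t11's draft).
[claim: Mochizuki2012, status: disputed] -/
theorem pStar_eq_prime_pow : pStar p = p ^ (if p = 2 then 2 else 1) := by
  have hp : p.Prime := Fact.out
  by_cases h2 : p = 2
  · subst h2
    rw [if_pos rfl]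
    decide
  · rw [if_neg h2, pow_one, pStar_of_odd (hp.eq_two_or_odd'.resolve_left h2)]

omit [ProperSpace K] in
/-- **IUTchIII:Def1.1(i)** (kurims p.24) the two concrete log-shells of the tree AGREE at the real
logarithm: abc-iut-L6-t3's `nonarchLogShell O logk p` (`O = {‖x‖ ≤ 1}`, `logk = log_p` on `O^×`; the
D4-canonical L6 log-shell) is abc-iut-L4-t3's `logShell` at the standard model `ofUnitLog p K`
(after abc-iut-L3-t11's draft, over its `nonarchLogShell_eq_image_logUnits`).
[claim: Mochizuki2012, status: disputed] -/
theorem nonarchLogShell_eq_logShell_ofUnitLog [CompleteSpace K] (O : ValuationSubring K)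
    (hO : ∀ x : K, x ∈ O ↔ ‖x‖ ≤ 1) (logk : Additive (↥O)ˣ →+ K)
    (hlog : ∀ u : (↥O)ˣ, logk (Additive.ofMul u) = unitLog ((u : ↥O) : K)) :
    nonarchLogShell O logk p = logShell (PadicLogOnUnits.ofUnitLog p K) := by
  rw [nonarchLogShell_eq_image_logUnits p O hO logk hlog, logShell_ofUnitLog p K, pStar_eq_prime_pow p,
    ← Set.image_smul]
  rfl

/-- **IUTchIII:Rmk1.2.2(iii)** (kurims p.37) "upper semi-commutativity", UNCONDITIONALLY at the real
logarithm: for every `n ≥ 1` the image of the `n`-th iterate of the log-link on its domain of definition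
lies in the log-shell `ℐ_K` — abc-iut-L6-t3's `iterate_image_subset_logShell` with its hypothesis
`ℐ* ⊆ ℐ` discharged by `preLogShell_subset_logShell_ofUnitLog`. [claim: Mochizuki2012, status: disputed] -/
theorem iterate_image_subset_logShell_ofUnitLog (n : ℕ) :
    ((PadicLogOnUnits.ofUnitLog p K).log^[n + 1]) '' iterDomain (PadicLogOnUnits.ofUnitLog p K) (n + 1) ⊆
      logShell (PadicLogOnUnits.ofUnitLog p K) :=
  iterate_image_subset_logShell _ (preLogShell_subset_logShell_ofUnitLog p K) n

end Literature.IUT.LogThetaLattice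

end
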